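import Summits.QuantumFields.YangMills.Theorems.FemtoTransferGapPositivity

/-!
# IMS localisation for the transfer quadratic form `⟨ψ, K_β ψ⟩` (kernel form of the Ismagilov–Morgan–Simon formula)
# (support module for the registered stub `stub_oneSiteEnergyLower` of crux `OneSiteLevels`, route `LuscherReduction`,
# item stmt-QuantumFields-20007; fleet lead prover ym-luscher-20007-p1)

The energy-LOWER-bound half of the one-site crux ONE («no intruder states», `stub_oneSiteEnergyLower`) needs an upper bound on
`⟨ψ,K_Bψ⟩` for EVERY physical `ψ` orthogonal to `k` constraint functions; the first step of every such argument is to cut `ψ` into pieces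
`J_aψ` localised near the 8 toron wells and in the outer region, with `Σ_a J_a² = 1`, and to control the price of the cut.  For a
Schrödinger operator this is the IMS formula `H = Σ J_aHJ_a − Σ|∇J_a|²`; for a transfer (kernel) operator the exact analogue is the identity

  `⟨ψ,Kψ⟩ = Σ_a ⟨J_aψ, K J_aψ⟩ + ½ ∫∫ ψ(U) K(U,V) ψ(V) Σ_a (J_a(U) − J_a(V))² dU dV`          (`ims_identity`)

(pointwise `Σ_a J_a(U)J_a(V) = 1 − ½Σ_a(J_a(U) − J_a(V))²`), and, for a SYMMETRIC non-negative kernel, the localisation-error bound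

  `⟨ψ,Kψ⟩ ≤ Σ_a ⟨J_aψ, K J_aψ⟩ + ½ M ‖ψ‖²`,  `M ≥ sup_U ∫ K(U,V) Σ_a (J_a(U) − J_a(V))² dV`            (`qform_le_sum_localized_add`)

(`ψ(U)ψ(V) ≤ ½(ψ(U)² + ψ(V)²)` under the non-negative weight, then the `U ↔ V` symmetry).  With cut-offs varying on link-angle scale `ℓ`
and the one-link factor concentrated at angles `≲ B^{−1/2}`, `M/λ₀ ≍ 1/(Bℓ²)`: the two-scale bookkeeping of the line card
`Lines/energy-lower-abs.md` (`ℓ ≍ λ_b^{1/2}` makes this `O(λ_b²)`, the slack of the crux).  Typed for every `L`, `β`, every continuous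
representation of a compact second-countable group (§1–§2), and specialised to the `SU(n)`/`SU(2)` kernels, whose symmetry is proved (§3).

## WHAT THIS IS NOT
No bound on `M` (that is the one-link Gaussian analysis), no choice of cut-offs, no statement about `β → ∞`; NOT the crux, NOT THE CLAY GAP.
Sorry-free; no new definition, no named fact.
-/

set_option autoImplicit false

noncomputable section

open MeasureTheory Filter Topology Real
open Literature.MathematicalPhysics.QuantumFieldTheory
open Literature.MathematicalPhysics.QuantumLattice
open Literature.Analysis.OperatorTheory.YMMatrixModel
open scoped BigOperators

namespace Summit.QuantumFields.YangMills.Theorems.FemtoTransferGap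

section IMS

variable {N : ℕ} {G : Type*} [Group G] [TopologicalSpace G] [IsTopologicalGroup G] [CompactSpace G]
  [MeasurableSpace G] [BorelSpace G] [SecondCountableTopology G]
variable (ρ : G →* Matrix (Fin N) (Fin N) ℂ)

omit [SecondCountableTopology G] in
/-- A bounded measurable function on the product of two configuration spaces is integrable for the product measure. [folklore] -/
theorem integrable_prod_of_bounded {L : ℕ} [NeZero L] {F : GaugeConfig 3 L G × GaugeConfig 3 L G → ℝ}
    (hF : AEStronglyMeasurable F ((configMeasure G L).prod (configMeasure G L))) {C : ℝ} (hC : ∀ p, |F p| ≤ C) :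
    Integrable F ((configMeasure G L).prod (configMeasure G L)) :=
  Integrable.mono' (integrable_const C) hF (ae_of_all _ fun p => by rw [Real.norm_eq_abs]; exact hC p)

/-- The integrand `ψ(U) K_β(U,V) φ(V) g(U,V)` of a weighted transfer form is integrable on the product space, for physical `ψ, φ`, a
continuous representation, and a bounded measurable weight `g`. [folklore] -/
theorem integrable_qformIntegrand_mul {L : ℕ} [NeZero L] (hρ : Continuous ρ) (β : ℝ)
    {ψ φ : GaugeConfig 3 L G → ℝ} (hψ : IsPhys ψ) (hφ : IsPhys φ)
    {g : GaugeConfig 3 L G × GaugeConfig 3 L G → ℝ} (hgm : Measurable g) {Cg : ℝ} (hg : ∀ p, |g p| ≤ Cg) :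
    Integrable (fun p : GaugeConfig 3 L G × GaugeConfig 3 L G => ψ p.1 * transferKernel ρ β p.1 p.2 * φ p.2 * g p)
      ((configMeasure G L).prod (configMeasure G L)) := by
  obtain ⟨M, hM⟩ := exists_transferKernel_le ρ hρ β (L := L)
  obtain ⟨C, hC⟩ := hψ.bounded
  obtain ⟨D, hD⟩ := hφ.bounded
  have hmeas : AEStronglyMeasurable
      (fun p : GaugeConfig 3 L G × GaugeConfig 3 L G => ψ p.1 * transferKernel ρ β p.1 p.2 * φ p.2 * g p)
      ((configMeasure G L).prod (configMeasure G L)) := by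
    refine AEStronglyMeasurable.mul (AEStronglyMeasurable.mul (AEStronglyMeasurable.mul ?_ ?_) ?_) ?_
    · exact (hψ.measurable.comp measurable_fst).aestronglyMeasurable
    · exact (continuous_transferKernel ρ hρ β).aestronglyMeasurable
    · exact (hφ.measurable.comp measurable_snd).aestronglyMeasurable
    · exact hgm.aestronglyMeasurable
  refine integrable_prod_of_bounded hmeas (C := C * M * D * Cg) fun p => ?_
  have hK0 : 0 < transferKernel ρ β p.1 p.2 := transferKernel_pos ρ β p.1 p.2
  rw [abs_mul, abs_mul, abs_mul, abs_of_pos hK0]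
  have hC0 : 0 ≤ C := (abs_nonneg _).trans (hC p.1)
  have hM0 : 0 ≤ M := hK0.le.trans (hM p.1 p.2)
  have hD0 : 0 ≤ D := (abs_nonneg _).trans (hD p.2)
  have h1 : |ψ p.1| * transferKernel ρ β p.1 p.2 ≤ C * M := mul_le_mul (hC p.1) (hM p.1 p.2) hK0.le hC0
  have h2 : |ψ p.1| * transferKernel ρ β p.1 p.2 * |φ p.2| ≤ C * M * D :=
    mul_le_mul h1 (hD p.2) (abs_nonneg _) (mul_nonneg hC0 hM0)
  exact mul_le_mul h2 (hg p) (abs_nonneg _) (mul_nonneg (mul_nonneg hC0 hM0) hD0)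

/-- Fubini for a weighted transfer form: the iterated integral `∫∫ ψ(U)K(U,V)φ(V)g(U,V) dV dU` is the product-measure integral. [folklore] -/
theorem integral_integral_qformIntegrand_mul {L : ℕ} [NeZero L] (hρ : Continuous ρ) (β : ℝ)
    {ψ φ : GaugeConfig 3 L G → ℝ} (hψ : IsPhys ψ) (hφ : IsPhys φ)
    {g : GaugeConfig 3 L G × GaugeConfig 3 L G → ℝ} (hgm : Measurable g) {Cg : ℝ} (hg : ∀ p, |g p| ≤ Cg) :
    ∫ U, ∫ V, ψ U * transferKernel ρ β U V * φ V * g (U, V) ∂configMeasure G L ∂configMeasure G L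
      = ∫ p, ψ p.1 * transferKernel ρ β p.1 p.2 * φ p.2 * g p ∂(configMeasure G L).prod (configMeasure G L) :=
  (integral_prod _ (integrable_qformIntegrand_mul ρ hρ β hψ hφ hgm hg)).symm

/-- The transfer form as a product-measure integral: `⟨ψ,K_βφ⟩ = ∫ ψ(U)K(U,V)φ(V) d(μ⊗μ)`. [folklore] -/
theorem qform_eq_integral_prod {L : ℕ} [NeZero L] (hρ : Continuous ρ) (β : ℝ)
    {ψ φ : GaugeConfig 3 L G → ℝ} (hψ : IsPhys ψ) (hφ : IsPhys φ) :
    qform ρ β ψ φ = ∫ p, ψ p.1 * transferKernel ρ β p.1 p.2 * φ p.2 ∂(configMeasure G L).prod (configMeasure G L) := by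
  have h := integral_integral_qformIntegrand_mul ρ hρ β hψ hφ (g := fun _ => (1 : ℝ)) measurable_const
    (Cg := 1) (fun _ => by simp)
  simp only [mul_one] at h
  exact h

omit [TopologicalSpace G] [IsTopologicalGroup G] [CompactSpace G] [BorelSpace G] [SecondCountableTopology G] in
/-- A product `J ψ` of a bounded measurable cut-off with a physical test function is bounded, measurable — and physical as soon as
`J` is gauge- and twist-invariant. [folklore] -/
theorem IsPhys.mul_of_invariant {L : ℕ} {J ψ : GaugeConfig 3 L G → ℝ} (hψ : IsPhys ψ) (hJm : Measurable J)
    {CJ : ℝ} (hJb : ∀ U, |J U| ≤ CJ)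
    (hJg : ∀ (g : Site 3 L → G) (U : GaugeConfig 3 L G), J (gaugeTransform g U) = J U)
    (hJz : ∀ (k : Fin 3), ∀ z ∈ Subgroup.center G, ∀ U : GaugeConfig 3 L G, J (twist k z U) = J U) :
    IsPhys (fun U => J U * ψ U) where
  measurable := hJm.mul hψ.measurable
  bounded := by
    obtain ⟨C, hC⟩ := hψ.bounded
    exact ⟨CJ * C, fun U => by rw [abs_mul]; exact mul_le_mul (hJb U) (hC U) (abs_nonneg _) ((abs_nonneg _).trans (hJb U))⟩
  gaugeInv := fun g U => by rw [hJg g U, hψ.gaugeInv g U]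
  zeroFlux := fun k z hz U => by rw [hJz k z hz U, hψ.zeroFlux k z hz U]

/-- Pointwise partition identity: `Σ_a J_a(U)J_a(V) = 1 − ½ Σ_a (J_a(U) − J_a(V))²` when `Σ_a J_a² ≡ 1`. [folklore] -/
theorem sum_mul_eq_one_sub_half_sum_sq {ι : Type*} [Fintype ι] {X : Type*} (J : ι → X → ℝ)
    (hJ : ∀ U, ∑ a, J a U ^ 2 = 1) (U V : X) :
    ∑ a, J a U * J a V = 1 - (1 / 2) * ∑ a, (J a U - J a V) ^ 2 := by
  have h : ∑ a, (J a U - J a V) ^ 2 = ∑ a, J a U ^ 2 + ∑ a, J a V ^ 2 - 2 * ∑ a, J a U * J a V := by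
    rw [Finset.mul_sum, ← Finset.sum_add_distrib, ← Finset.sum_sub_distrib]
    exact Finset.sum_congr rfl fun a _ => by ring
  rw [h, hJ U, hJ V]
  ring

/-- Each cut-off of a quadratic partition of unity is bounded by `1`. [folklore] -/
theorem abs_le_one_of_sum_sq_eq_one {ι : Type*} [Fintype ι] {X : Type*} (J : ι → X → ℝ)
    (hJ : ∀ U, ∑ a, J a U ^ 2 = 1) (a : ι) (U : X) : |J a U| ≤ 1 := by
  have h1 : J a U ^ 2 ≤ ∑ b, J b U ^ 2 :=
    Finset.single_le_sum (f := fun b => J b U ^ 2) (fun b _ => sq_nonneg _) (Finset.mem_univ a)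
  rw [hJ U] at h1
  exact abs_le_one_iff_mul_self_le_one.mpr (by nlinarith [h1])

/-- **IMS identity for the transfer form.**  For a finite quadratic partition of unity `Σ_a J_a² ≡ 1` by measurable cut-offs `J_a` that are
gauge- and twist-invariant (so that each `J_aψ` is again physical), and a physical `ψ`:
`⟨ψ,K_βψ⟩ = Σ_a ⟨J_aψ, K_β J_aψ⟩ + ½ ∫ ψ(U) K_β(U,V) ψ(V) Σ_a (J_a(U) − J_a(V))² d(μ⊗μ)`.  (Ismagilov–Morgan–Simon localisation in kernel form.)
[cite: SimonB1983DiscreteSpectrum, §3] -/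
theorem ims_identity {L : ℕ} [NeZero L] (hρ : Continuous ρ) (β : ℝ) {ι : Type*} [Fintype ι]
    (J : ι → GaugeConfig 3 L G → ℝ) (hJm : ∀ a, Measurable (J a)) (hJ : ∀ U, ∑ a, J a U ^ 2 = 1)
    (hJg : ∀ a (g : Site 3 L → G) (U : GaugeConfig 3 L G), J a (gaugeTransform g U) = J a U)
    (hJz : ∀ a (k : Fin 3), ∀ z ∈ Subgroup.center G, ∀ U : GaugeConfig 3 L G, J a (twist k z U) = J a U)
    {ψ : GaugeConfig 3 L G → ℝ} (hψ : IsPhys ψ) :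
    qform ρ β ψ ψ = ∑ a, qform ρ β (fun U => J a U * ψ U) (fun U => J a U * ψ U)
      + (1 / 2) * ∫ p, ψ p.1 * transferKernel ρ β p.1 p.2 * ψ p.2 * ∑ a, (J a p.1 - J a p.2) ^ 2
          ∂(configMeasure G L).prod (configMeasure G L) := by
  set Pm := (configMeasure G L).prod (configMeasure G L) with hPm
  have hJ1 : ∀ a U, |J a U| ≤ 1 := abs_le_one_of_sum_sq_eq_one J hJ
  have hJψ : ∀ a, IsPhys (fun U => J a U * ψ U) := fun a => hψ.mul_of_invariant (hJm a) (hJ1 a) (hJg a) (hJz a)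
  -- each localized form as a product integral with weight `J_a ⊗ J_a`
  have hloc : ∀ a, qform ρ β (fun U => J a U * ψ U) (fun U => J a U * ψ U)
      = ∫ p, ψ p.1 * transferKernel ρ β p.1 p.2 * ψ p.2 * (J a p.1 * J a p.2) ∂Pm := by
    intro a
    rw [qform_eq_integral_prod ρ hρ β (hJψ a) (hJψ a)]
    refine integral_congr_ae (ae_of_all _ fun p => ?_)
    simp only
    ring
  have hwm : ∀ a, Measurable fun p : GaugeConfig 3 L G × GaugeConfig 3 L G => J a p.1 * J a p.2 :=
    fun a => ((hJm a).comp measurable_fst).mul ((hJm a).comp measurable_snd)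
  have hwb : ∀ a (p : GaugeConfig 3 L G × GaugeConfig 3 L G), |J a p.1 * J a p.2| ≤ 1 := fun a p => by
    rw [abs_mul]
    exact mul_le_one₀ (hJ1 a p.1) (abs_nonneg _) (hJ1 a p.2)
  have hint : ∀ a, Integrable (fun p : GaugeConfig 3 L G × GaugeConfig 3 L G =>
      ψ p.1 * transferKernel ρ β p.1 p.2 * ψ p.2 * (J a p.1 * J a p.2)) Pm :=
    fun a => integrable_qformIntegrand_mul ρ hρ β hψ hψ (hwm a) (hwb a)
  -- the defect weight `D = Σ_a (J_a(U) − J_a(V))²` is measurable and bounded by `4 |ι|`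
  have hDm : Measurable fun p : GaugeConfig 3 L G × GaugeConfig 3 L G => ∑ a, (J a p.1 - J a p.2) ^ 2 :=
    Finset.measurable_sum _ fun a _ => (((hJm a).comp measurable_fst).sub ((hJm a).comp measurable_snd)).pow_const 2
  have hDb : ∀ p : GaugeConfig 3 L G × GaugeConfig 3 L G, |∑ a, (J a p.1 - J a p.2) ^ 2| ≤ 4 * Fintype.card ι := by
    intro p
    rw [abs_of_nonneg (Finset.sum_nonneg fun a _ => sq_nonneg _)]
    calc ∑ a, (J a p.1 - J a p.2) ^ 2 ≤ ∑ _a : ι, (4 : ℝ) := Finset.sum_le_sum fun a _ => by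
            have h1 := hJ1 a p.1
            have h2 := hJ1 a p.2
            rw [abs_le] at h1 h2
            nlinarith
      _ = 4 * Fintype.card ι := by simp [mul_comm]
  have hintD : Integrable (fun p : GaugeConfig 3 L G × GaugeConfig 3 L G =>
      ψ p.1 * transferKernel ρ β p.1 p.2 * ψ p.2 * ∑ a, (J a p.1 - J a p.2) ^ 2) Pm :=
    integrable_qformIntegrand_mul ρ hρ β hψ hψ hDm hDb
  -- assemble
  rw [qform_eq_integral_prod ρ hρ β hψ hψ]
  simp_rw [hloc]
  rw [← integral_finsetSum _ fun a _ => hint a, ← integral_const_mul, ← integral_add]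
  · refine integral_congr_ae (ae_of_all _ fun p => ?_)
    simp only
    have key := sum_mul_eq_one_sub_half_sum_sq J hJ p.1 p.2
    have : ∑ a, ψ p.1 * transferKernel ρ β p.1 p.2 * ψ p.2 * (J a p.1 * J a p.2)
        = ψ p.1 * transferKernel ρ β p.1 p.2 * ψ p.2 * ∑ a, J a p.1 * J a p.2 := by
      rw [Finset.mul_sum]
    rw [this, key]
    ring
  · exact integrable_finsetSum _ fun a _ => hint a
  · exact hintD.const_mul _

/-- **IMS localisation inequality for the transfer form (symmetric kernel).**  Under the hypotheses of `ims_identity`, if the kernel is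
symmetric and `M` bounds the defect row-integrals, `∫ K_β(U,V) Σ_a (J_a(U) − J_a(V))² dV ≤ M` for every `U`, then
`⟨ψ,K_βψ⟩ ≤ Σ_a ⟨J_aψ, K_β J_aψ⟩ + ½ M ‖ψ‖²` (`ψ(U)ψ(V) ≤ ½(ψ(U)² + ψ(V)²)` against the non-negative weight `K·D`, and the `U ↔ V` symmetry
of `K·D` under the product measure). [cite: SimonB1983DiscreteSpectrum, §3] -/
theorem qform_le_sum_localized_add {L : ℕ} [NeZero L] (hρ : Continuous ρ) (β : ℝ)
    (hsymm : ∀ U V : GaugeConfig 3 L G, transferKernel ρ β U V = transferKernel ρ β V U)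
    {ι : Type*} [Fintype ι]
    (J : ι → GaugeConfig 3 L G → ℝ) (hJm : ∀ a, Measurable (J a)) (hJ : ∀ U, ∑ a, J a U ^ 2 = 1)
    (hJg : ∀ a (g : Site 3 L → G) (U : GaugeConfig 3 L G), J a (gaugeTransform g U) = J a U)
    (hJz : ∀ a (k : Fin 3), ∀ z ∈ Subgroup.center G, ∀ U : GaugeConfig 3 L G, J a (twist k z U) = J a U)
    {M : ℝ} (hM : ∀ U : GaugeConfig 3 L G,
      ∫ V, transferKernel ρ β U V * ∑ a, (J a U - J a V) ^ 2 ∂configMeasure G L ≤ M)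
    {ψ : GaugeConfig 3 L G → ℝ} (hψ : IsPhys ψ) :
    qform ρ β ψ ψ ≤ ∑ a, qform ρ β (fun U => J a U * ψ U) (fun U => J a U * ψ U) + (1 / 2) * M * l2 ψ ψ := by
  set μ := configMeasure G L with hμ
  set Pm := μ.prod μ with hPm
  set K : GaugeConfig 3 L G × GaugeConfig 3 L G → ℝ := fun p => transferKernel ρ β p.1 p.2 with hK
  set D : GaugeConfig 3 L G × GaugeConfig 3 L G → ℝ := fun p => ∑ a, (J a p.1 - J a p.2) ^ 2 with hD
  have hJ1 : ∀ a U, |J a U| ≤ 1 := abs_le_one_of_sum_sq_eq_one J hJ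
  obtain ⟨C, hC⟩ := hψ.bounded
  obtain ⟨Mk, hMk⟩ := exists_transferKernel_le ρ hρ β (L := L)
  have hD0 : ∀ p, 0 ≤ D p := fun p => Finset.sum_nonneg fun a _ => sq_nonneg _
  have hDm : Measurable D :=
    Finset.measurable_sum _ fun a _ => (((hJm a).comp measurable_fst).sub ((hJm a).comp measurable_snd)).pow_const 2
  have hDb : ∀ p : GaugeConfig 3 L G × GaugeConfig 3 L G, |D p| ≤ 4 * Fintype.card ι := by
    intro p
    rw [abs_of_nonneg (hD0 p)]
    calc D p = ∑ a, (J a p.1 - J a p.2) ^ 2 := rfl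
      _ ≤ ∑ _a : ι, (4 : ℝ) := Finset.sum_le_sum fun a _ => by
            have h1 := hJ1 a p.1
            have h2 := hJ1 a p.2
            rw [abs_le] at h1 h2
            nlinarith
      _ = 4 * Fintype.card ι := by simp [mul_comm]
  have hKD_symm : ∀ p : GaugeConfig 3 L G × GaugeConfig 3 L G, K p.swap * D p.swap = K p * D p := by
    intro p
    simp only [hK, hD, Prod.fst_swap, Prod.snd_swap]
    rw [hsymm p.2 p.1]
    congr 1
    exact Finset.sum_congr rfl fun a _ => by ring
  -- the identity
  have hid := ims_identity ρ hρ β J hJm hJ hJg hJz hψ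
  -- the remainder `R = ∫ ψ(U)Kψ(V)D` is at most `∫ ψ(U)² K D`
  have hKm : AEStronglyMeasurable K Pm := (continuous_transferKernel ρ hρ β).aestronglyMeasurable
  have hsqU : Integrable (fun p : GaugeConfig 3 L G × GaugeConfig 3 L G => ψ p.1 ^ 2 * (K p * D p)) Pm := by
    have hm : AEStronglyMeasurable (fun p : GaugeConfig 3 L G × GaugeConfig 3 L G => ψ p.1 ^ 2 * (K p * D p)) Pm :=
      ((hψ.measurable.comp measurable_fst).pow_const 2).aestronglyMeasurable.mul (hKm.mul hDm.aestronglyMeasurable)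
    refine integrable_prod_of_bounded hm (C := C ^ 2 * (Mk * (4 * Fintype.card ι))) fun p => ?_
    have hK0 : 0 < K p := transferKernel_pos ρ β p.1 p.2
    rw [abs_mul, abs_mul, abs_of_pos hK0, abs_pow]
    refine mul_le_mul (pow_le_pow_left₀ (abs_nonneg _) (hC p.1) 2) ?_ (by positivity) (by positivity)
    exact mul_le_mul (hMk p.1 p.2) (hDb p) (abs_nonneg _) (hK0.le.trans (hMk p.1 p.2))
  have hsqV : Integrable (fun p : GaugeConfig 3 L G × GaugeConfig 3 L G => ψ p.2 ^ 2 * (K p * D p)) Pm := by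
    have hm : AEStronglyMeasurable (fun p : GaugeConfig 3 L G × GaugeConfig 3 L G => ψ p.2 ^ 2 * (K p * D p)) Pm :=
      ((hψ.measurable.comp measurable_snd).pow_const 2).aestronglyMeasurable.mul (hKm.mul hDm.aestronglyMeasurable)
    refine integrable_prod_of_bounded hm (C := C ^ 2 * (Mk * (4 * Fintype.card ι))) fun p => ?_
    have hK0 : 0 < K p := transferKernel_pos ρ β p.1 p.2
    rw [abs_mul, abs_mul, abs_of_pos hK0, abs_pow]
    refine mul_le_mul (pow_le_pow_left₀ (abs_nonneg _) (hC p.2) 2) ?_ (by positivity) (by positivity)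
    exact mul_le_mul (hMk p.1 p.2) (hDb p) (abs_nonneg _) (hK0.le.trans (hMk p.1 p.2))
  -- symmetry: `∫ ψ(V)² K D = ∫ ψ(U)² K D`
  have hswap : ∫ p, ψ p.2 ^ 2 * (K p * D p) ∂Pm = ∫ p, ψ p.1 ^ 2 * (K p * D p) ∂Pm := by
    have h := integral_prod_swap (μ := μ) (ν := μ)
      (fun p : GaugeConfig 3 L G × GaugeConfig 3 L G => ψ p.1 ^ 2 * (K p * D p))
    -- `h : ∫ p, (fun q => ψ q.1^2 * (K q * D q)) p.swap ∂(μ.prod μ) = ∫ p, ψ p.1^2 * (K p * D p) ∂(μ.prod μ)`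
    rw [← h]
    refine integral_congr_ae (ae_of_all _ fun p => ?_)
    simp only [Prod.fst_swap]
    rw [hKD_symm p]
  have hR : ∫ p, ψ p.1 * transferKernel ρ β p.1 p.2 * ψ p.2 * ∑ a, (J a p.1 - J a p.2) ^ 2 ∂Pm
      ≤ ∫ p, ψ p.1 ^ 2 * (K p * D p) ∂Pm := by
    have hle : ∫ p, ψ p.1 * transferKernel ρ β p.1 p.2 * ψ p.2 * ∑ a, (J a p.1 - J a p.2) ^ 2 ∂Pm
        ≤ ∫ p, ((1 / 2) * (ψ p.1 ^ 2 * (K p * D p)) + (1 / 2) * (ψ p.2 ^ 2 * (K p * D p))) ∂Pm := by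
      refine integral_mono (integrable_qformIntegrand_mul ρ hρ β hψ hψ hDm hDb)
        ((hsqU.const_mul _).add (hsqV.const_mul _)) fun p => ?_
      have hw : 0 ≤ K p * D p := mul_nonneg (transferKernel_pos ρ β p.1 p.2).le (hD0 p)
      have h2 : ψ p.1 * ψ p.2 ≤ (1 / 2) * (ψ p.1 ^ 2 + ψ p.2 ^ 2) := by nlinarith [sq_nonneg (ψ p.1 - ψ p.2)]
      calc ψ p.1 * transferKernel ρ β p.1 p.2 * ψ p.2 * ∑ a, (J a p.1 - J a p.2) ^ 2
          = (ψ p.1 * ψ p.2) * (K p * D p) := by simp only [hK, hD]; ring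
        _ ≤ (1 / 2) * (ψ p.1 ^ 2 + ψ p.2 ^ 2) * (K p * D p) := mul_le_mul_of_nonneg_right h2 hw
        _ = (1 / 2) * (ψ p.1 ^ 2 * (K p * D p)) + (1 / 2) * (ψ p.2 ^ 2 * (K p * D p)) := by ring
    rw [integral_add (hsqU.const_mul _) (hsqV.const_mul _), integral_const_mul, integral_const_mul, hswap] at hle
    linarith
  -- `∫ ψ(U)² K D d(μ⊗μ) = ∫ ψ(U)² (∫ K D dV) dU ≤ M ‖ψ‖²`
  have hrow : ∫ p, ψ p.1 ^ 2 * (K p * D p) ∂Pm ≤ M * l2 ψ ψ := by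
    rw [integral_prod _ hsqU]
    have hl2 : l2 ψ ψ = ∫ U, ψ U ^ 2 ∂μ := by simp only [l2, pow_two, hμ]
    rw [hl2, ← integral_const_mul]
    refine integral_mono_of_nonneg (ae_of_all _ fun U => ?_) ((hψ.integrable_sq).const_mul M) (ae_of_all _ fun U => ?_)
    · exact integral_nonneg fun V => mul_nonneg (sq_nonneg _)
        (mul_nonneg (transferKernel_pos ρ β _ _).le (hD0 (U, V)))
    · show ∫ V, ψ (U, V).1 ^ 2 * (K (U, V) * D (U, V)) ∂μ ≤ M * ψ U ^ 2
      simp only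
      rw [integral_const_mul, mul_comm]
      exact mul_le_mul_of_nonneg_right (hM U) (sq_nonneg _)
  rw [hid]
  have h12 : (0 : ℝ) ≤ 1 / 2 := by norm_num
  nlinarith [mul_le_mul_of_nonneg_left (hR.trans hrow) h12]

end IMS

/-! ### §3. Symmetry of the `SU(n)` / `SU(2)` transfer kernels, and the `SU(2)` form of the IMS inequality -/

section SU

variable {n : ℕ}

/-- The time-like coupling of the fundamental representation of `SU(n)` is symmetric (it is a Gram kernel). [folklore] -/
theorem timeCoupling_fundamentalRep_symm {L : ℕ} [NeZero L]
    (U V : GaugeConfig 3 L (Matrix.specialUnitaryGroup (Fin n) ℂ)) :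
    timeCoupling (fundamentalRep (Fin n)) U V = timeCoupling (fundamentalRep (Fin n)) V U := by
  rw [timeCoupling_fundamentalRep_eq_gram, timeCoupling_fundamentalRep_eq_gram]
  exact Finset.sum_congr rfl fun a _ => mul_comm _ _

/-- The `SU(n)` transfer kernel is symmetric: `K_β(U,V) = K_β(V,U)`. [folklore] -/
theorem transferKernel_fundamentalRep_symm {L : ℕ} [NeZero L] (β : ℝ)
    (U V : GaugeConfig 3 L (Matrix.specialUnitaryGroup (Fin n) ℂ)) :
    transferKernel (fundamentalRep (Fin n)) β U V = transferKernel (fundamentalRep (Fin n)) β V U := by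
  unfold transferKernel
  rw [timeCoupling_fundamentalRep_symm, add_comm (wilsonAction _ U)]

/-- The `SU(2)` transfer kernel of the leaves is symmetric. [folklore] -/
theorem transferKernel_su2Rep_symm {L : ℕ} [NeZero L] (β : ℝ) (U V : GaugeConfig 3 L SU2) :
    transferKernel su2Rep β U V = transferKernel su2Rep β V U :=
  transferKernel_fundamentalRep_symm β U V

/-- **IMS localisation inequality for the `SU(2)` transfer form** (every `L`, every `β`): for a finite quadratic partition of unity by
measurable gauge- and twist-invariant cut-offs `J_a` and a defect bound `∫ K_β(U,V) Σ_a (J_a(U) − J_a(V))² dV ≤ M` uniform in `U`,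
every physical `ψ` satisfies `⟨ψ,K_βψ⟩ ≤ Σ_a ⟨J_aψ, K_β J_aψ⟩ + ½ M ‖ψ‖²`. [cite: SimonB1983DiscreteSpectrum, §3] -/
theorem qform_su2Rep_le_sum_localized_add {L : ℕ} [NeZero L] (β : ℝ) {ι : Type*} [Fintype ι]
    (J : ι → GaugeConfig 3 L SU2 → ℝ) (hJm : ∀ a, Measurable (J a)) (hJ : ∀ U, ∑ a, J a U ^ 2 = 1)
    (hJg : ∀ a (g : Site 3 L → SU2) (U : GaugeConfig 3 L SU2), J a (gaugeTransform g U) = J a U)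
    (hJz : ∀ a (k : Fin 3), ∀ z ∈ Subgroup.center SU2, ∀ U : GaugeConfig 3 L SU2, J a (twist k z U) = J a U)
    {M : ℝ} (hM : ∀ U : GaugeConfig 3 L SU2,
      ∫ V, transferKernel su2Rep β U V * ∑ a, (J a U - J a V) ^ 2 ∂configMeasure SU2 L ≤ M)
    {ψ : GaugeConfig 3 L SU2 → ℝ} (hψ : IsPhys ψ) :
    qform su2Rep β ψ ψ ≤ ∑ a, qform su2Rep β (fun U => J a U * ψ U) (fun U => J a U * ψ U) + (1 / 2) * M * l2 ψ ψ := by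
  haveI : SecondCountableTopology (Matrix (Fin 2) (Fin 2) ℂ) :=
    inferInstanceAs (SecondCountableTopology (Fin 2 → Fin 2 → ℂ))
  haveI : SecondCountableTopology SU2 := TopologicalSpace.Subtype.secondCountableTopology _
  exact qform_le_sum_localized_add su2Rep continuous_su2Rep β (transferKernel_su2Rep_symm β) J hJm hJ hJg hJz hM hψ

end SU

end Summit.QuantumFields.YangMills.Theorems.FemtoTransferGap

end
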